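import Literature.Topology.FourManifolds.TrisectionFunctorSPC4Proofs
import Literature.Topology.FourManifolds.GroupTrisectionsConnectSum

/-!
# `AgkCor6Sufficiency` — negative-side support: the "for every marking" form of a stabilisation
# stub is the one-marking form PLUS re-marking invariance (Nielsen lifting in disguise)

Crux item `stmt-SmoothPoincare4-10894`, line `level-set-kirby-triple`
(`Cruxes/AgkCor6Sufficiency/Lines/level-set-kirby-triple.lean`), stub `stub_levelStabilizeOne`
(statement `LevelStabilizeOne`): for a level datum `d` of type `(g; κ)` and a slot `i` there is a
level datum `d'` of type `(g+1; κ + eᵢ)` such that FOR EVERY based marking `(x₀, μ)` of the central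
surface of `d` some based marking `(x₀', μ')` of `d'` has
`Iso (d'.kernels x₀' μ') ((d.kernels x₀ μ).stabilizeOne i)`.  The line's card and `PICKED.md` state
that the composition runs "WITHOUT Nielsen lifting" and that the tree gap of `Disproof.lean` §10
(`Iso K K' → Iso K.stabilize K'.stabilize` is in tree only for liftable automorphisms,
`TrisectionKernels.Iso.stabilize_of_lift`) is "circumvented" by re-marking
(`exists_marking_groupGKTrisectionOf_eq`).

This file records, kernel-checked and in full generality (any operation `Φ` on kernel triples, any
two Gay–Kirby trisections `S`, `S'` of any genera), that the gap is NOT circumvented but RELOCATED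
into the inner `∀ μ` of the stub:

* `iso_apply_of_forall_marking` — if every marking `μ` of `S` at `x₀` is answered by a based
  marking of `S'` with `Iso (𝒢(S', x₀', μ')) (Φ (𝒢(S, x₀, μ)))`, then `Φ` is constant up to `Iso`
  on ALL markings of `S` at `x₀`: `Iso (Φ (𝒢 μ₁)) (Φ (𝒢 μ₂))` (the two answers are kernel triples
  of the same trisection `S'`, hence `Iso` by `groupGKTrisectionOf_iso` — base points may differ);
* `iso_apply_map_of_forall_marking` — equivalently `Iso (Φ K) (Φ (α • K))` for the geometric triple
  `K = 𝒢(S, x₀, μ)` and EVERY automorphism `α` of `S_g` (`α • K = (K i).map α`), i.e. for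
  `Φ = (·).stabilizeOne i` exactly the statement "unbalanced stabilisation is well defined on
  isomorphism classes" on the triples of `S`, which the tree derives only from a Nielsen lift of
  `α` (`TrisectionKernels.iso_stabilize_map_of_lift` for the balanced `stabilize`; hypothesis `hN`
  of `exists_stabilized_gkTrisection_of_geometric_of_nielsen` /
  `TrisectionKernels.Iso.stabilizeIter_of_liftable`);
* `forall_marking_of_exists_marking` — conversely the `∀ μ` form follows from the ONE-marking
  (geometric, Gay–Kirby Lemma 10 "one eye") form together with that invariance.

So `stub_levelStabilizeOne` = (geometric one-slot stabilisation for one marking) + (re-marking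
invariance of `stabilizeOne` on level-datum triples), and the second summand is the Nielsen-type
obligation shared with fact (c′); the line carries EIGHT obligations, not seven.  Nothing here is
false: Nielsen's theorem (Nielsen 1927; Zieschang–Vogt–Coldewey 1980, §5; Lyndon–Schupp 1977,
Ch. I §4 and Prop. II.5.8) makes every `α` liftable on paper.  Nothing here concludes the crux, a
Theses decl, or the stub.

References: A. Abrams, D. Gay, R. Kirby, *Group trisections and smooth 4-manifolds*, Geom. Topol.
22 (2018), Def. 2–3, Thm. 5, p. 1540 (the map `𝒢`); D. Gay, R. Kirby, *Trisecting 4-manifolds*,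
Geom. Topol. 20 (2016), Lemma 10; R. Lyndon, P. Schupp, *Combinatorial Group Theory* (1977),
Ch. I §4 (Nielsen), Prop. II.5.8 (Magnus).
-/

noncomputable section

namespace Summit.SmoothPoincare4.SmoothPoincare4.Theorems.AgkCor6Sufficiency.Negative

open Literature.Topology.FourManifolds

universe u v

variable {X : Type u} [TopologicalSpace X] [ChartedSpace (EuclideanSpace ℝ (Fin 4)) X]
  {X' : Type v} [TopologicalSpace X'] [T2Space X'] [ChartedSpace (EuclideanSpace ℝ (Fin 4)) X']
  {g g' : ℕ} {κ : Fin 3 → ℕ} {κ' : Fin 3 → ℕ} {S : Fin 3 → Set X} {S' : Fin 3 → Set X'}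

/-- **Re-marking at the same base point is the `Aut S_g`-action on the kernel triple** (on the
nose): `𝒢(S, x₀, α⁻¹ ≫ μ) = α • 𝒢(S, x₀, μ)`.  (The computation of
`Theorems/GroupTrisectionRemarking.lean`, over `IsGKTrisection`.) [folklore] -/
theorem groupGKTrisectionOf_symm_trans (h : IsGKTrisection X g κ S) (x₀ : centralSurface S)
    (μ : SurfaceGroup g ≃* FundamentalGroup (centralSurface S) x₀)
    (α : SurfaceGroup g ≃* SurfaceGroup g) :
    groupGKTrisectionOf h x₀ (α.symm.trans μ) =
      fun i => (groupGKTrisectionOf h x₀ μ i).map α.toMonoidHom := by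
  funext i
  ext γ
  simp only [groupGKTrisectionOf, Subgroup.mem_comap, Subgroup.mem_map, MulEquiv.coe_toMonoidHom,
    MulEquiv.trans_apply]
  constructor
  · intro hγ
    exact ⟨α.symm γ, hγ, by simp⟩
  · rintro ⟨δ, hδ, rfl⟩
    simpa using hδ

/-- **The `∀ μ` form forces re-marking invariance.**  Let `Φ` be any operation from genus-`g` to
genus-`g'` kernel triples (e.g. `(·).stabilizeOne i`, `(·).stabilize`, `(·).stabilizeIter n`).  If
every based marking `μ` of the central surface of `S` at `x₀` is answered by a based marking of the
trisection `S'` whose kernel triple is `Iso` to `Φ (𝒢(S, x₀, μ))` — the shape of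
`LevelStabilizeOne` / of fact (c′) — then `Φ` takes `Iso` values on any two markings at `x₀`:
both answers are kernel triples of `S'`, which are `Iso` for all base points and markings
(`groupGKTrisectionOf_iso`). [cite: AbramsGayKirby2018, p. 1540 (the map 𝒢) and Def. 3] -/
theorem iso_apply_of_forall_marking (h : IsGKTrisection X g κ S) (h' : IsGKTrisection X' g' κ' S')
    (Φ : TrisectionKernels g → TrisectionKernels g') (x₀ : centralSurface S)
    (hS : ∀ μ : SurfaceGroup g ≃* FundamentalGroup (centralSurface S) x₀,
      ∃ (x₀' : centralSurface S') (μ' : SurfaceGroup g' ≃* FundamentalGroup (centralSurface S') x₀'),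
        TrisectionKernels.Iso (groupGKTrisectionOf h' x₀' μ') (Φ (groupGKTrisectionOf h x₀ μ)))
    (μ₁ μ₂ : SurfaceGroup g ≃* FundamentalGroup (centralSurface S) x₀) :
    TrisectionKernels.Iso (Φ (groupGKTrisectionOf h x₀ μ₁)) (Φ (groupGKTrisectionOf h x₀ μ₂)) := by
  obtain ⟨x₁, ν₁, iso₁⟩ := hS μ₁
  obtain ⟨x₂, ν₂, iso₂⟩ := hS μ₂
  exact iso₁.symm.trans ((groupGKTrisectionOf_iso h' h' x₁ x₂ ν₁ ν₂).trans iso₂)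

/-- **The `∀ μ` form forces `Φ` to be well defined on the `Aut S_g`-orbit of the geometric
triple**: `Iso (Φ K) (Φ (α • K))` for `K = 𝒢(S, x₀, μ)` and EVERY automorphism `α` of `S_g`,
orientation-reversing and non-liftable-so-far ones included.  For `Φ = (·).stabilizeOne i` /
`(·).stabilize` this is the statement the tree obtains only from a Nielsen lift of `α`
(`TrisectionKernels.iso_stabilize_map_of_lift`), i.e. the §10 tree gap of `Disproof.lean`.
[cite: AbramsGayKirby2018, Def. 3 (p. 1540)] -/
theorem iso_apply_map_of_forall_marking (h : IsGKTrisection X g κ S)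
    (h' : IsGKTrisection X' g' κ' S') (Φ : TrisectionKernels g → TrisectionKernels g')
    (x₀ : centralSurface S)
    (hS : ∀ μ : SurfaceGroup g ≃* FundamentalGroup (centralSurface S) x₀,
      ∃ (x₀' : centralSurface S') (μ' : SurfaceGroup g' ≃* FundamentalGroup (centralSurface S') x₀'),
        TrisectionKernels.Iso (groupGKTrisectionOf h' x₀' μ') (Φ (groupGKTrisectionOf h x₀ μ)))
    (μ : SurfaceGroup g ≃* FundamentalGroup (centralSurface S) x₀)
    (α : SurfaceGroup g ≃* SurfaceGroup g) :
    TrisectionKernels.Iso (Φ (groupGKTrisectionOf h x₀ μ))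
      (Φ (fun i => (groupGKTrisectionOf h x₀ μ i).map α.toMonoidHom)) := by
  rw [← groupGKTrisectionOf_symm_trans h x₀ μ α]
  exact iso_apply_of_forall_marking h h' Φ x₀ hS μ (α.symm.trans μ)

omit [T2Space X'] in
/-- **Conversely, the `∀ μ` form is the one-marking form plus re-marking invariance.**  If SOME
marking `μ₀` of `S` at `x₀` is answered by a based marking of `S'` (the geometric content:
Gay–Kirby's Lemma 10 for one eye, read through one marking), and `Φ` takes `Iso` values on any two
markings at `x₀` (the algebraic content: Nielsen lifting, cf.
`exists_stabilized_gkTrisection_of_geometric_of_nielsen`), then EVERY marking is answered.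
[cite: GayKirby2016, Lemma 10] [cite: AbramsGayKirby2018, Def. 3 and Thm. 5] -/
theorem forall_marking_of_exists_marking (h : IsGKTrisection X g κ S)
    (h' : IsGKTrisection X' g' κ' S') (Φ : TrisectionKernels g → TrisectionKernels g')
    (x₀ : centralSurface S)
    (hgeom : ∃ (μ₀ : SurfaceGroup g ≃* FundamentalGroup (centralSurface S) x₀)
      (x₀' : centralSurface S') (μ' : SurfaceGroup g' ≃* FundamentalGroup (centralSurface S') x₀'),
        TrisectionKernels.Iso (groupGKTrisectionOf h' x₀' μ') (Φ (groupGKTrisectionOf h x₀ μ₀)))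
    (hinv : ∀ μ₁ μ₂ : SurfaceGroup g ≃* FundamentalGroup (centralSurface S) x₀,
      TrisectionKernels.Iso (Φ (groupGKTrisectionOf h x₀ μ₁)) (Φ (groupGKTrisectionOf h x₀ μ₂))) :
    ∀ μ : SurfaceGroup g ≃* FundamentalGroup (centralSurface S) x₀,
      ∃ (x₀' : centralSurface S') (μ' : SurfaceGroup g' ≃* FundamentalGroup (centralSurface S') x₀'),
        TrisectionKernels.Iso (groupGKTrisectionOf h' x₀' μ') (Φ (groupGKTrisectionOf h x₀ μ)) := by
  intro μ
  obtain ⟨μ₀, x₀', μ', iso⟩ := hgeom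
  exact ⟨x₀', μ', iso.trans (hinv μ₀ μ)⟩

/-- **Re-marking invariance at a base point = invariance under the whole `Aut S_g`-orbit.**  The
hypothesis `hinv` of `forall_marking_of_exists_marking` is equivalent to
`∀ μ α, Iso (Φ (𝒢 μ)) (Φ (α • 𝒢 μ))`: any two markings at `x₀` differ by an automorphism of
`S_g`. [folklore] -/
theorem forall_markings_iso_iff_forall_mulEquiv (h : IsGKTrisection X g κ S)
    (Φ : TrisectionKernels g → TrisectionKernels g') (x₀ : centralSurface S) :
    (∀ μ₁ μ₂ : SurfaceGroup g ≃* FundamentalGroup (centralSurface S) x₀,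
      TrisectionKernels.Iso (Φ (groupGKTrisectionOf h x₀ μ₁)) (Φ (groupGKTrisectionOf h x₀ μ₂))) ↔
    (∀ (μ : SurfaceGroup g ≃* FundamentalGroup (centralSurface S) x₀)
      (α : SurfaceGroup g ≃* SurfaceGroup g),
      TrisectionKernels.Iso (Φ (groupGKTrisectionOf h x₀ μ))
        (Φ (fun i => (groupGKTrisectionOf h x₀ μ i).map α.toMonoidHom))) := by
  constructor
  · intro hinv μ α
    rw [← groupGKTrisectionOf_symm_trans h x₀ μ α]
    exact hinv μ _
  · intro hmap μ₁ μ₂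
    -- `μ₂ = α⁻¹ ≫ μ₁` for `α := μ₁ ≫ μ₂⁻¹`
    have key := hmap μ₁ (μ₁.trans μ₂.symm)
    rw [← groupGKTrisectionOf_symm_trans h x₀ μ₁ (μ₁.trans μ₂.symm)] at key
    have hμ : (μ₁.trans μ₂.symm).symm.trans μ₁ = μ₂ := by
      ext γ
      simp
    rwa [hμ] at key

end Summit.SmoothPoincare4.SmoothPoincare4.Theorems.AgkCor6Sufficiency.Negative

end
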